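import Summits.QuantumFields.YangMills.Theorems.IsotropyFromPowerCountingTemperedCurvatureMomentsThreePointKernelPart3

/-!
# Three-point kernel — stub `stub_threePointKernel` (E) of crux `TemperedCurvatureMoments`

Stub E of reshape 4 of the registered skeleton `Cruxes/TemperedCurvatureMoments/Lines/Sketch.lean`
(crux stmt-QuantumFields-17721, line `Sketch`), registered signature verbatim.  It is the ASSEMBLY stub: it
takes the statements of stubs B (`stub_threePointChartBounds`), C (`stub_threeSlotRegularity`) and D
(`stub_chartSelection`) as hypotheses and produces, for a one-species family `𝔖` with the OS package,
translations, proper signed permutations, eight planar frames, the planar cone and diagonal product reflection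
positivity, a kernel `K₃` continuous on the injective locus of `(ℝ⁴)³`, dominated by T's weight
`C (1+‖y‖)ᴺ (1 + Σᵢ Σ_{j≠i} ‖yᵢ−yⱼ‖⁻¹)ᴺ`, and representing `𝔖₃` on compactly supported test functions
supported in the injective locus.

Proof (composition of the landed parts 1–3, `…ThreePointKernelPart1/2/3`):
* stub B at `𝔖` gives Schwartz orders `M₁` (ordered pairs, all frames) and, with diagonal product RP, `M₂`
  (disjoint pairs, diagonal frames); both bounds hold at `M₀ = max M₁ M₂` (`schwartzNorm_mono`);
* stub C at `M₀` gives `N₁, q, B₀`; the constants `C_N, p_N` of stub B for `N ≤ N₁` are made uniform by the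
  finite sums `Cst = 1 + Σ_{N ≤ N₁} (|C¹_N| + |C²_N|)`, `pst = Σ_{N ≤ N₁} (p¹_N + p²_N)` (`1/δ ≥ 1`);
* at an injective `y`, stub D gives two good slots at scale `c·r`; with `m` the least pairwise distance and
  `s = min 1 (min (c r) m)`, `ThreePointKernel.exists_localKernel` gives a continuous local kernel on
  `∏ B(yᵢ, s/16)` bounded by `Cst (2/s)^pst · B₀ (8/s)^q (1+‖y‖)^q`, which `inv_scale_le` and
  `local_bound_le_weight` turn into T's weight with exponent `pst + q`;
* `ThreePointKernel.exists_kernel_of_local₃` glues the local kernels on the injective locus.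

HONEST LABEL: one registered assembly stub of one line of crux T; registry progress only — `stub_diagonalProductRP`
(crux-D type) and the UV stub `stub_shieldedMomentBoundSubseqFour` remain; T, the route and the Yang–Mills mass gap are
NOT proved.  References: Osterwalder–Schrader, Comm. Math. Phys. 31 (1973) §2, §4; Hörmander, ALPDO I, Thm. 1.2.5,
§2.2, §8.1. [folklore]
-/

noncomputable section

namespace Summit.QuantumFields.YangMills.Theorems.TemperedCurvatureMoments.Sketch

open scoped BigOperators SchwartzMap
open MeasureTheory Filter Topology Set Metric
open Literature.MathematicalPhysics.QuantumFieldTheory Literature.MathematicalPhysics.QuantumLattice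
open Literature.MathematicalPhysics.AQFT
open Summit.QuantumFields.YangMills.Theorems.NPointIsotropy.Negative (E4)
open Summit.QuantumFields.YangMills.Theorems.CurvatureBoostCovariance.Negative
  (OSPackage Translations Hypercubic EightFrameRP PlanarCone)

namespace ThreePointKernel

/-! ## Bookkeeping: monotonicity of a chart bound in its constants -/

/-- **Monotonicity of a chart bound.** A bound `S ≤ C dᵖ a b g` with `d ≥ 1` and nonnegative `a, b, g`
persists when `C` is replaced by any `C' ≥ |C|`, `p` by any `p' ≥ p`, and `a, b, g` by larger quantities.
[folklore] -/
theorem chart_bound_mono {S C C' d a b g a' b' g' : ℝ} {p p' : ℕ}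
    (h : S ≤ C * d ^ p * a * b * g) (hC : |C| ≤ C') (hd : 1 ≤ d) (hp : p ≤ p')
    (ha : 0 ≤ a) (hb : 0 ≤ b) (hg : 0 ≤ g) (ha' : a ≤ a') (hb' : b ≤ b') (hg' : g ≤ g') :
    S ≤ C' * d ^ p' * a' * b' * g' := by
  have hd0 : 0 ≤ d := zero_le_one.trans hd
  have ha'0 : 0 ≤ a' := ha.trans ha'
  have hb'0 : 0 ≤ b' := hb.trans hb'
  have hdp : d ^ p ≤ d ^ p' := pow_le_pow_right₀ hd hp
  have hX : 0 ≤ d ^ p * a * b * g := by positivity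
  have h1 : C * d ^ p * a * b * g ≤ |C| * (d ^ p * a * b * g) := by
    rw [show C * d ^ p * a * b * g = C * (d ^ p * a * b * g) by ring]
    exact mul_le_mul_of_nonneg_right (le_abs_self C) hX
  have h2 : d ^ p * a * b * g ≤ d ^ p' * a' * b' * g' :=
    mul_le_mul (mul_le_mul (mul_le_mul hdp ha' ha (by positivity)) hb' hb (by positivity)) hg' hg
      (by positivity)
  have h3 : |C| * (d ^ p * a * b * g) ≤ C' * (d ^ p' * a' * b' * g') :=
    mul_le_mul hC h2 hX ((abs_nonneg C).trans hC)
  calc S ≤ C * d ^ p * a * b * g := h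
    _ ≤ |C| * (d ^ p * a * b * g) := h1
    _ ≤ C' * (d ^ p' * a' * b' * g') := h3
    _ = C' * d ^ p' * a' * b' * g' := by ring

/-- A term of a finite sum of nonnegative reals over `range (N₁ + 1)` is at most `1 +` the sum. [folklore] -/
theorem le_one_add_sum_range {u : ℕ → ℝ} (hu : ∀ i, 0 ≤ u i) {N₁ N : ℕ} (hN : N ≤ N₁) :
    u N ≤ 1 + ∑ i ∈ Finset.range (N₁ + 1), u i := by
  have hmem : N ∈ Finset.range (N₁ + 1) := Finset.mem_range.2 (Nat.lt_succ_of_le hN)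
  have h := Finset.single_le_sum (f := u) (fun i _ => hu i) hmem
  linarith

/-- A term of a finite sum of naturals over `range (N₁ + 1)` is at most the sum. [folklore] -/
theorem le_sum_range_nat {u : ℕ → ℕ} {N₁ N : ℕ} (hN : N ≤ N₁) :
    u N ≤ ∑ i ∈ Finset.range (N₁ + 1), u i :=
  Finset.single_le_sum (f := u) (fun _ _ => Nat.zero_le _) (Finset.mem_range.2 (Nat.lt_succ_of_le hN))

/-! ## Bookkeeping: the least pairwise distance of a triple -/

/-- **The least pairwise distance of an injective triple**: a positive `m`, below every pairwise distance,
attained at some pair. [folklore] -/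
theorem exists_min_dist (y : Fin 3 → E4) (hy : Function.Injective y) :
    ∃ m : ℝ, 0 < m ∧ (∀ i j, i ≠ j → m ≤ dist (y i) (y j)) ∧ ∃ i j, i ≠ j ∧ m = dist (y i) (y j) := by
  classical
  -- the finite set of ordered pairs of distinct slots and the least distance over it
  have hP : ((Finset.univ : Finset (Fin 3 × Fin 3)).filter (fun p => p.1 ≠ p.2)).Nonempty :=
    ⟨((0 : Fin 3), (1 : Fin 3)), Finset.mem_filter.2 ⟨Finset.mem_univ _, show (0 : Fin 3) ≠ 1 by decide⟩⟩
  obtain ⟨p₀, hp₀, hinf⟩ := Finset.exists_mem_eq_inf' hP (fun p : Fin 3 × Fin 3 => dist (y p.1) (y p.2))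
  have hp₀ne : p₀.1 ≠ p₀.2 := (Finset.mem_filter.1 hp₀).2
  refine ⟨((Finset.univ : Finset (Fin 3 × Fin 3)).filter (fun p => p.1 ≠ p.2)).inf' hP
      (fun p : Fin 3 × Fin 3 => dist (y p.1) (y p.2)), ?_, fun i j hij => ?_, p₀.1, p₀.2, hp₀ne, hinf⟩
  · rw [hinf]
    exact dist_pos.2 fun h => hp₀ne (hy h)
  · exact Finset.inf'_le (fun p : Fin 3 × Fin 3 => dist (y p.1) (y p.2))
      (Finset.mem_filter.2 ⟨Finset.mem_univ (i, j), hij⟩)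

end ThreePointKernel

open ThreePointKernel in
/-- **Stub E `stub_threePointKernel` (assembly; takes the STATEMENTS of stubs B, C, D as hypotheses).**  For a family with
the OS package, translations, proper signed permutations, eight frames, cone and diagonal product RP: a kernel `K₃`,
continuous on the injective locus of `(ℝ⁴)³`, with `|K₃(y)| ≤ C (1+‖y‖)ᴺ (1 + Σᵢ Σ_{j≠i} ‖yᵢ−yⱼ‖⁻¹)ᴺ`, representing `𝔖₃`
on compactly supported test functions supported in the injective locus.  Proof: at `y`, stub D gives two good slots with
gaps `≥ c r`; with `s = min 1 (min (c r) m)` (`m` the least pairwise distance) the chart bounds of stub B (slot order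
adjusted by E3, constants made uniform over `N ≤ N₁` and over the two Schwartz orders) are the slot bounds of stub C for
`Λ = 𝔖₃ / (Cst (2/s)^pst)` (`ThreePointKernel.exists_localKernel`); the local kernels are dominated by the weight
(`inv_scale_le`, `local_bound_le_weight`) and glue on the injective locus (`exists_kernel_of_local₃`). [folklore] -/
theorem stub_threePointKernel :
    (∀ (S₁ : SchwingerFamily E4), OSPackage S₁ → Translations S₁ → Hypercubic S₁ → EightFrameRP S₁ → PlanarCone S₁ →
      (∃ M₀ : ℕ, ∀ N : ℕ, ∃ (C : ℝ) (p : ℕ), ∀ (n v : E4),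
          ((∃ (μ ν : Fin 4) (s s' : ℝ), μ ≠ ν ∧ (s = 1 ∨ s = -1) ∧ (s' = 1 ∨ s' = -1) ∧
            n = s • (EuclideanSpace.single μ (1 : ℝ) : E4) ∧ v = s' • (EuclideanSpace.single ν (1 : ℝ) : E4)) ∨
          (∃ (μ ν : Fin 4) (s s' : ℝ), μ ≠ ν ∧ (s = 1 ∨ s = -1) ∧ (s' = 1 ∨ s' = -1) ∧
            n = (Real.sqrt 2)⁻¹ • (s • (EuclideanSpace.single μ (1 : ℝ) : E4) + s' • (EuclideanSpace.single ν (1 : ℝ) : E4)) ∧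
            v = (Real.sqrt 2)⁻¹ • (s • (EuclideanSpace.single μ (1 : ℝ) : E4) - s' • (EuclideanSpace.single ν (1 : ℝ) : E4)))) →
          ∀ δ : ℝ, 0 < δ → δ ≤ 1 → ∀ (c : ℝ) (f₁ f₂ g : 𝓢(E4, ℂ)),
            HasCompactSupport (f₁ : E4 → ℂ) → HasCompactSupport (f₂ : E4 → ℂ) → HasCompactSupport (g : E4 → ℂ) →
            tsupport (f₁ : E4 → ℂ) ⊆ {x : E4 | inner ℝ x n < c} → tsupport (f₂ : E4 → ℂ) ⊆ {x : E4 | inner ℝ x n < c} →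
            tsupport (g : E4 → ℂ) ⊆ {x : E4 | c + δ < inner ℝ x n} →
            (∃ c' : ℝ, (tsupport (f₁ : E4 → ℂ) ⊆ {x : E4 | inner ℝ x n < c'} ∧ tsupport (f₂ : E4 → ℂ) ⊆ {x : E4 | c' < inner ℝ x n}) ∨
              (tsupport (f₂ : E4 → ℂ) ⊆ {x : E4 | inner ℝ x n < c'} ∧ tsupport (f₁ : E4 → ℂ) ⊆ {x : E4 | c' < inner ℝ x n})) →
            ∀ w : E4, (w = n ∨ w = v) → ∀ F : 𝓢((Fin 3 → E4), ℂ),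
              IsTensorOf F ![f₁, f₂, ((LineDeriv.lineDerivOp w : 𝓢(E4, ℂ) → 𝓢(E4, ℂ))^[N] g)] →
                ‖S₁ 3 F‖ ≤ C * (1 / δ) ^ p * schwartzNorm M₀ f₁ * schwartzNorm M₀ f₂ * schwartzNorm M₀ g) ∧
      ((∀ (R : E4 ≃ₗᵢ[ℝ] E4) (a b : ℝ), a ^ 2 = 1 / 2 → b ^ 2 = 1 / 2 →
        R (EuclideanSpace.single (0 : Fin 4) (1 : ℝ)) = a • EuclideanSpace.single (0 : Fin 4) (1 : ℝ) + b • EuclideanSpace.single (1 : Fin 4) (1 : ℝ) →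
        (∀ (N : ℕ) (deg : Fin N → ℕ) (g : (j : Fin N) → Fin (deg j) → 𝓢(E4, ℂ))
          (F : (j : Fin N) → 𝓢((Fin (deg j) → E4), ℂ)),
          (∀ j, IsTensorOf (F j) (g j)) →
          (∀ j i, HasCompactSupport (g j i : E4 → ℂ) ∧ tsupport (g j i : E4 → ℂ) ⊆ {x : E4 | 0 < x 0}) →
          (∀ j i i', i ≠ i' → Disjoint (tsupport (g j i : E4 → ℂ)) (tsupport (g j i' : E4 → ℂ))) →
          ∀ H : (i j : Fin N) → 𝓢((Fin (deg i + deg j) → E4), ℂ),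
            (∀ i j, IsAppendTensorOf (H i j) (osAdjoint (F i)) (F j)) →
              0 ≤ (∑ i, ∑ j, (fun m => (S₁ m).comp (linActMulti R)) (deg i + deg j) (H i j)).re ∧ (∑ i, ∑ j, (fun m => (S₁ m).comp (linActMulti R)) (deg i + deg j) (H i j)).im = 0)) →
        ∃ M₀ : ℕ, ∀ N : ℕ, ∃ (C : ℝ) (p : ℕ), ∀ (n v : E4),
          (∃ (μ ν : Fin 4) (s s' : ℝ), μ ≠ ν ∧ (s = 1 ∨ s = -1) ∧ (s' = 1 ∨ s' = -1) ∧
            n = (Real.sqrt 2)⁻¹ • (s • (EuclideanSpace.single μ (1 : ℝ) : E4) + s' • (EuclideanSpace.single ν (1 : ℝ) : E4)) ∧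
            v = (Real.sqrt 2)⁻¹ • (s • (EuclideanSpace.single μ (1 : ℝ) : E4) - s' • (EuclideanSpace.single ν (1 : ℝ) : E4))) →
          ∀ δ : ℝ, 0 < δ → δ ≤ 1 → ∀ (c : ℝ) (f₁ f₂ g : 𝓢(E4, ℂ)),
            HasCompactSupport (f₁ : E4 → ℂ) → HasCompactSupport (f₂ : E4 → ℂ) → HasCompactSupport (g : E4 → ℂ) →
            tsupport (f₁ : E4 → ℂ) ⊆ {x : E4 | inner ℝ x n < c} → tsupport (f₂ : E4 → ℂ) ⊆ {x : E4 | inner ℝ x n < c} →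
            tsupport (g : E4 → ℂ) ⊆ {x : E4 | c + δ < inner ℝ x n} →
            Disjoint (tsupport (f₁ : E4 → ℂ)) (tsupport (f₂ : E4 → ℂ)) →
            ∀ w : E4, (w = n ∨ w = v) → ∀ F : 𝓢((Fin 3 → E4), ℂ),
              IsTensorOf F ![f₁, f₂, ((LineDeriv.lineDerivOp w : 𝓢(E4, ℂ) → 𝓢(E4, ℂ))^[N] g)] →
                ‖S₁ 3 F‖ ≤ C * (1 / δ) ^ p * schwartzNorm M₀ f₁ * schwartzNorm M₀ f₂ * schwartzNorm M₀ g)) →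
    (∀ M₀ : ℕ, ∃ (N₁ q : ℕ) (B₀ : ℝ), ∀ (D : Fin 3 → Finset E4),
      (∀ k, ∀ t ∈ D k, (∃ n v : E4, ((∃ (μ ν : Fin 4) (s s' : ℝ), μ ≠ ν ∧ (s = 1 ∨ s = -1) ∧ (s' = 1 ∨ s' = -1) ∧
            n = s • (EuclideanSpace.single μ (1 : ℝ) : E4) ∧ v = s' • (EuclideanSpace.single ν (1 : ℝ) : E4)) ∨
          (∃ (μ ν : Fin 4) (s s' : ℝ), μ ≠ ν ∧ (s = 1 ∨ s = -1) ∧ (s' = 1 ∨ s' = -1) ∧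
            n = (Real.sqrt 2)⁻¹ • (s • (EuclideanSpace.single μ (1 : ℝ) : E4) + s' • (EuclideanSpace.single ν (1 : ℝ) : E4)) ∧
            v = (Real.sqrt 2)⁻¹ • (s • (EuclideanSpace.single μ (1 : ℝ) : E4) - s' • (EuclideanSpace.single ν (1 : ℝ) : E4)))) ∧ (t = n ∨ t = v))) →
      (⊤ ≤ Submodule.span ℝ ((⋃ k : Fin 3, (fun t : E4 => (Pi.single k t : Fin 3 → E4)) '' (D k : Set E4)) ∪
          Set.range (fun μ : Fin 4 => fun _ : Fin 3 => (EuclideanSpace.single μ (1 : ℝ) : E4)))) →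
      ∀ (x : Fin 3 → E4) (ρ : ℝ), 0 < ρ → ρ ≤ 1 → (∀ i j, i ≠ j → 2 * ρ < dist (x i) (x j)) →
      ∀ Λ : 𝓢((Fin 3 → E4), ℂ) →L[ℂ] ℂ,
        (∀ (a : E4) (F : 𝓢((Fin 3 → E4), ℂ)), IsOffDiagonal F → Λ (translateMulti a F) = Λ F) →
        (∀ (k : Fin 3), ∀ t ∈ D k, ∀ N : ℕ, N ≤ N₁ → ∀ f : Fin 3 → 𝓢(E4, ℂ),
          (∀ i, tsupport (f i : E4 → ℂ) ⊆ Metric.ball (x i) ρ) → ∀ F : 𝓢((Fin 3 → E4), ℂ),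
            IsTensorOf F (Function.update f k ((LineDeriv.lineDerivOp t : 𝓢(E4, ℂ) → 𝓢(E4, ℂ))^[N] (f k))) →
              ‖Λ F‖ ≤ ∏ i, schwartzNorm M₀ (f i)) →
        ∃ K₃ : (Fin 3 → E4) → ℂ, ContinuousOn K₃ {y | ∀ i, y i ∈ Metric.ball (x i) (ρ / 2)} ∧
          (∀ y : Fin 3 → E4, (∀ i, y i ∈ Metric.ball (x i) (ρ / 2)) → ‖K₃ y‖ ≤ B₀ * ρ⁻¹ ^ q * (1 + ‖x‖) ^ q) ∧
          ∀ F : 𝓢((Fin 3 → E4), ℂ), tsupport (F : (Fin 3 → E4) → ℂ) ⊆ {y | ∀ i, y i ∈ Metric.ball (x i) (ρ / 2)} →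
            Integrable (fun y => K₃ y * F y) ∧ Λ F = ∫ y, K₃ y * F y) →
    (∃ c : ℝ, 0 < c ∧ ∀ y : Fin 3 → E4, Function.Injective y →
      ∃ r : ℝ, 0 < r ∧ (∃ i j, i ≠ j ∧ dist (y i) (y j) ≤ r) ∧ ∃ k₁ k₂ : Fin 3, k₁ ≠ k₂ ∧
          ((∃ (μ : Fin 4) (s : ℝ), (s = 1 ∨ s = -1) ∧
              (∀ i, i ≠ k₁ → inner ℝ (y i) (s • (EuclideanSpace.single μ (1 : ℝ) : E4)) + c * r ≤
                inner ℝ (y k₁) (s • (EuclideanSpace.single μ (1 : ℝ) : E4))) ∧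
              (∀ i i', i ≠ k₁ → i' ≠ k₁ → i ≠ i' →
                c * r ≤ |inner ℝ (y i) (EuclideanSpace.single μ (1 : ℝ) : E4) - inner ℝ (y i') (EuclideanSpace.single μ (1 : ℝ) : E4)|)) ∨
            (∃ t : Fin 4 → E4, LinearIndependent ℝ t ∧ ∀ j, ∃ n v : E4, (∃ (μ ν : Fin 4) (s s' : ℝ), μ ≠ ν ∧ (s = 1 ∨ s = -1) ∧ (s' = 1 ∨ s' = -1) ∧
            n = (Real.sqrt 2)⁻¹ • (s • (EuclideanSpace.single μ (1 : ℝ) : E4) + s' • (EuclideanSpace.single ν (1 : ℝ) : E4)) ∧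
            v = (Real.sqrt 2)⁻¹ • (s • (EuclideanSpace.single μ (1 : ℝ) : E4) - s' • (EuclideanSpace.single ν (1 : ℝ) : E4))) ∧ (t j = n ∨ t j = v) ∧
              ∀ i, i ≠ k₁ → inner ℝ (y i) n + c * r ≤ inner ℝ (y k₁) n)) ∧
          ((∃ (μ : Fin 4) (s : ℝ), (s = 1 ∨ s = -1) ∧
              (∀ i, i ≠ k₂ → inner ℝ (y i) (s • (EuclideanSpace.single μ (1 : ℝ) : E4)) + c * r ≤
                inner ℝ (y k₂) (s • (EuclideanSpace.single μ (1 : ℝ) : E4))) ∧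
              (∀ i i', i ≠ k₂ → i' ≠ k₂ → i ≠ i' →
                c * r ≤ |inner ℝ (y i) (EuclideanSpace.single μ (1 : ℝ) : E4) - inner ℝ (y i') (EuclideanSpace.single μ (1 : ℝ) : E4)|)) ∨
            (∃ t : Fin 4 → E4, LinearIndependent ℝ t ∧ ∀ j, ∃ n v : E4, (∃ (μ ν : Fin 4) (s s' : ℝ), μ ≠ ν ∧ (s = 1 ∨ s = -1) ∧ (s' = 1 ∨ s' = -1) ∧
            n = (Real.sqrt 2)⁻¹ • (s • (EuclideanSpace.single μ (1 : ℝ) : E4) + s' • (EuclideanSpace.single ν (1 : ℝ) : E4)) ∧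
            v = (Real.sqrt 2)⁻¹ • (s • (EuclideanSpace.single μ (1 : ℝ) : E4) - s' • (EuclideanSpace.single ν (1 : ℝ) : E4))) ∧ (t j = n ∨ t j = v) ∧
              ∀ i, i ≠ k₂ → inner ℝ (y i) n + c * r ≤ inner ℝ (y k₂) n))) →
    ∀ (S₁ : SchwingerFamily E4), OSPackage S₁ → Translations S₁ → Hypercubic S₁ → EightFrameRP S₁ → PlanarCone S₁ →
      (∀ (R : E4 ≃ₗᵢ[ℝ] E4) (a b : ℝ), a ^ 2 = 1 / 2 → b ^ 2 = 1 / 2 →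
        R (EuclideanSpace.single (0 : Fin 4) (1 : ℝ)) = a • EuclideanSpace.single (0 : Fin 4) (1 : ℝ) + b • EuclideanSpace.single (1 : Fin 4) (1 : ℝ) →
        (∀ (N : ℕ) (deg : Fin N → ℕ) (g : (j : Fin N) → Fin (deg j) → 𝓢(E4, ℂ))
          (F : (j : Fin N) → 𝓢((Fin (deg j) → E4), ℂ)),
          (∀ j, IsTensorOf (F j) (g j)) →
          (∀ j i, HasCompactSupport (g j i : E4 → ℂ) ∧ tsupport (g j i : E4 → ℂ) ⊆ {x : E4 | 0 < x 0}) →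
          (∀ j i i', i ≠ i' → Disjoint (tsupport (g j i : E4 → ℂ)) (tsupport (g j i' : E4 → ℂ))) →
          ∀ H : (i j : Fin N) → 𝓢((Fin (deg i + deg j) → E4), ℂ),
            (∀ i j, IsAppendTensorOf (H i j) (osAdjoint (F i)) (F j)) →
              0 ≤ (∑ i, ∑ j, (fun m => (S₁ m).comp (linActMulti R)) (deg i + deg j) (H i j)).re ∧ (∑ i, ∑ j, (fun m => (S₁ m).comp (linActMulti R)) (deg i + deg j) (H i j)).im = 0)) →
        ∃ (K₃ : (Fin 3 → E4) → ℂ) (C : ℝ) (N : ℕ), 0 < C ∧ ContinuousOn K₃ {y | Function.Injective y} ∧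
          (∀ y : Fin 3 → E4, Function.Injective y →
            ‖K₃ y‖ ≤ C * (1 + ‖y‖) ^ N * (1 + ∑ i, ∑ j ∈ Finset.univ.erase i, ‖y i - y j‖⁻¹) ^ N) ∧
          ∀ F : 𝓢((Fin 3 → E4), ℂ), HasCompactSupport (F : (Fin 3 → E4) → ℂ) →
            tsupport (F : (Fin 3 → E4) → ℂ) ⊆ {y | Function.Injective y} →
              Integrable (fun y => K₃ y * F y) ∧ S₁ 3 F = ∫ y, K₃ y * F y := by
  intro hB hC hD S₁ hOS htr hhyp h8 hcone hPRP
  -- E3 and translations for `𝔖₃`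
  have hsymm : ∀ (π : Equiv.Perm (Fin 3)) (F : 𝓢((Fin 3 → E4), ℂ)), IsOffDiagonal F →
      S₁ 3 (permTest π F) = S₁ 3 F := fun π F hF => by
    simpa only [SchwingerFamily.toLabelled_apply] using hOS.2.2.2.2.1 3 (fun _ => ()) π F hF
  have htr3 : ∀ (a : E4) (F : 𝓢((Fin 3 → E4), ℂ)), IsOffDiagonal F → S₁ 3 (translateMulti a F) = S₁ 3 F :=
    fun a F hF => htr 3 a F hF
  -- stub B at `S₁`: the two Schwartz orders, made one
  obtain ⟨⟨M₁, hM₁⟩, hB₂⟩ := hB S₁ hOS htr hhyp h8 hcone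
  obtain ⟨M₂, hM₂⟩ := hB₂ hPRP
  choose C₁ p₁ hC₁ using hM₁
  choose C₂ p₂ hC₂ using hM₂
  set M₀ : ℕ := max M₁ M₂ with hM₀
  have hM₁le : M₁ ≤ M₀ := le_max_left _ _
  have hM₂le : M₂ ≤ M₀ := le_max_right _ _
  -- stub C at `M₀`
  obtain ⟨N₁, q, B₀, hreg⟩ := hC M₀
  -- uniform constants for `N ≤ N₁`
  set Cst : ℝ := 1 + ∑ i ∈ Finset.range (N₁ + 1), (|C₁ i| + |C₂ i|) with hCst_def
  set pst : ℕ := ∑ i ∈ Finset.range (N₁ + 1), (p₁ i + p₂ i) with hpst_def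
  have hCst : 0 < Cst := by
    have : 0 ≤ ∑ i ∈ Finset.range (N₁ + 1), (|C₁ i| + |C₂ i|) :=
      Finset.sum_nonneg fun i _ => add_nonneg (abs_nonneg _) (abs_nonneg _)
    rw [hCst_def]
    linarith
  have hC₁le : ∀ N, N ≤ N₁ → |C₁ N| ≤ Cst := fun N hN =>
    ((le_add_of_nonneg_right (abs_nonneg (C₂ N))).trans
      (le_one_add_sum_range (u := fun i => |C₁ i| + |C₂ i|)
        (fun i => add_nonneg (abs_nonneg _) (abs_nonneg _)) hN))
  have hC₂le : ∀ N, N ≤ N₁ → |C₂ N| ≤ Cst := fun N hN =>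
    ((le_add_of_nonneg_left (abs_nonneg (C₁ N))).trans
      (le_one_add_sum_range (u := fun i => |C₁ i| + |C₂ i|)
        (fun i => add_nonneg (abs_nonneg _) (abs_nonneg _)) hN))
  have hp₁le : ∀ N, N ≤ N₁ → p₁ N ≤ pst := fun N hN =>
    (Nat.le_add_right _ _).trans (le_sum_range_nat (u := fun i => p₁ i + p₂ i) hN)
  have hp₂le : ∀ N, N ≤ N₁ → p₂ N ≤ pst := fun N hN =>
    (Nat.le_add_left _ _).trans (le_sum_range_nat (u := fun i => p₁ i + p₂ i) hN)
  -- the axis chart bounds (ordered pairs) with the uniform constants at order `M₀`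
  have hAX : ∀ N : ℕ, N ≤ N₁ → ∀ (μ ν : Fin 4) (s s' : ℝ), μ ≠ ν → (s = 1 ∨ s = -1) → (s' = 1 ∨ s' = -1) →
      ∀ δ : ℝ, 0 < δ → δ ≤ 1 → ∀ (c : ℝ) (f₁ f₂ g : 𝓢(E4, ℂ)),
        HasCompactSupport (f₁ : E4 → ℂ) → HasCompactSupport (f₂ : E4 → ℂ) → HasCompactSupport (g : E4 → ℂ) →
        tsupport (f₁ : E4 → ℂ) ⊆ {x : E4 | inner ℝ x (s • (EuclideanSpace.single μ (1 : ℝ) : E4)) < c} →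
        tsupport (f₂ : E4 → ℂ) ⊆ {x : E4 | inner ℝ x (s • (EuclideanSpace.single μ (1 : ℝ) : E4)) < c} →
        tsupport (g : E4 → ℂ) ⊆ {x : E4 | c + δ < inner ℝ x (s • (EuclideanSpace.single μ (1 : ℝ) : E4))} →
        (∃ c' : ℝ, (tsupport (f₁ : E4 → ℂ) ⊆ {x : E4 | inner ℝ x (s • (EuclideanSpace.single μ (1 : ℝ) : E4)) < c'} ∧
            tsupport (f₂ : E4 → ℂ) ⊆ {x : E4 | c' < inner ℝ x (s • (EuclideanSpace.single μ (1 : ℝ) : E4))}) ∨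
          (tsupport (f₂ : E4 → ℂ) ⊆ {x : E4 | inner ℝ x (s • (EuclideanSpace.single μ (1 : ℝ) : E4)) < c'} ∧
            tsupport (f₁ : E4 → ℂ) ⊆ {x : E4 | c' < inner ℝ x (s • (EuclideanSpace.single μ (1 : ℝ) : E4))})) →
        ∀ w : E4, (w = s • (EuclideanSpace.single μ (1 : ℝ) : E4) ∨ w = s' • (EuclideanSpace.single ν (1 : ℝ) : E4)) →
        ∀ F : 𝓢((Fin 3 → E4), ℂ),
          IsTensorOf F ![f₁, f₂, ((LineDeriv.lineDerivOp w : 𝓢(E4, ℂ) → 𝓢(E4, ℂ))^[N] g)] →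
            ‖S₁ 3 F‖ ≤ Cst * (1 / δ) ^ pst * schwartzNorm M₀ f₁ * schwartzNorm M₀ f₂ * schwartzNorm M₀ g := by
    intro N hN μ ν s s' hμν hs hs' δ hδ hδ1 c f₁ f₂ g hf₁c hf₂c hgc hf₁ hf₂ hg hord w hw F hF
    have h := hC₁ N (s • (EuclideanSpace.single μ (1 : ℝ) : E4)) (s' • (EuclideanSpace.single ν (1 : ℝ) : E4))
      (Or.inl ⟨μ, ν, s, s', hμν, hs, hs', rfl, rfl⟩) δ hδ hδ1 c f₁ f₂ g hf₁c hf₂c hgc hf₁ hf₂ hg hord w hw F hF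
    exact chart_bound_mono h (hC₁le N hN) (one_le_one_div hδ hδ1) (hp₁le N hN) (schwartzNorm_nonneg _ _)
      (schwartzNorm_nonneg _ _) (schwartzNorm_nonneg _ _) (schwartzNorm_mono hM₁le _)
      (schwartzNorm_mono hM₁le _) (schwartzNorm_mono hM₁le _)
  -- the diagonal chart bounds (disjoint pairs) with the uniform constants at order `M₀`
  have hDG : ∀ N : ℕ, N ≤ N₁ → ∀ (n v : E4),
      (∃ (μ ν : Fin 4) (s s' : ℝ), μ ≠ ν ∧ (s = 1 ∨ s = -1) ∧ (s' = 1 ∨ s' = -1) ∧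
        n = (Real.sqrt 2)⁻¹ • (s • (EuclideanSpace.single μ (1 : ℝ) : E4) + s' • (EuclideanSpace.single ν (1 : ℝ) : E4)) ∧
        v = (Real.sqrt 2)⁻¹ • (s • (EuclideanSpace.single μ (1 : ℝ) : E4) - s' • (EuclideanSpace.single ν (1 : ℝ) : E4))) →
      ∀ δ : ℝ, 0 < δ → δ ≤ 1 → ∀ (c : ℝ) (f₁ f₂ g : 𝓢(E4, ℂ)),
        HasCompactSupport (f₁ : E4 → ℂ) → HasCompactSupport (f₂ : E4 → ℂ) → HasCompactSupport (g : E4 → ℂ) →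
        tsupport (f₁ : E4 → ℂ) ⊆ {x : E4 | inner ℝ x n < c} → tsupport (f₂ : E4 → ℂ) ⊆ {x : E4 | inner ℝ x n < c} →
        tsupport (g : E4 → ℂ) ⊆ {x : E4 | c + δ < inner ℝ x n} →
        Disjoint (tsupport (f₁ : E4 → ℂ)) (tsupport (f₂ : E4 → ℂ)) →
        ∀ w : E4, (w = n ∨ w = v) → ∀ F : 𝓢((Fin 3 → E4), ℂ),
          IsTensorOf F ![f₁, f₂, ((LineDeriv.lineDerivOp w : 𝓢(E4, ℂ) → 𝓢(E4, ℂ))^[N] g)] →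
            ‖S₁ 3 F‖ ≤ Cst * (1 / δ) ^ pst * schwartzNorm M₀ f₁ * schwartzNorm M₀ f₂ * schwartzNorm M₀ g := by
    intro N hN n v hnv δ hδ hδ1 c f₁ f₂ g hf₁c hf₂c hgc hf₁ hf₂ hg hdis w hw F hF
    have h := hC₂ N n v hnv δ hδ hδ1 c f₁ f₂ g hf₁c hf₂c hgc hf₁ hf₂ hg hdis w hw F hF
    exact chart_bound_mono h (hC₂le N hN) (one_le_one_div hδ hδ1) (hp₂le N hN) (schwartzNorm_nonneg _ _)
      (schwartzNorm_nonneg _ _) (schwartzNorm_nonneg _ _) (schwartzNorm_mono hM₂le _)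
      (schwartzNorm_mono hM₂le _) (schwartzNorm_mono hM₂le _)
  -- stub D
  obtain ⟨c, hc, hsel⟩ := hD
  -- the constants of the weight
  set a : ℝ := 1 + (min c 1)⁻¹ with ha_def
  have ha : 0 ≤ a := by
    have : 0 ≤ (min c 1)⁻¹ := inv_nonneg.2 (le_min hc.le zero_le_one)
    rw [ha_def]
    linarith
  set Cfin : ℝ := Cst * |B₀| * 2 ^ pst * 8 ^ q * a ^ (pst + q) + 1 with hCfin_def
  have hCfin : 0 < Cfin := by positivity
  -- glue the local kernels
  refine (exists_kernel_of_local₃ (S₁ 3)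
    (fun y => Cfin * (1 + ‖y‖) ^ (pst + q) * (1 + ∑ i, ∑ j ∈ Finset.univ.erase i, ‖y i - y j‖⁻¹) ^ (pst + q))
    (fun y hy => ?_)).elim fun K₃ hK => ⟨K₃, Cfin, pst + q, hCfin, hK.1, hK.2.1, hK.2.2⟩
  -- the local kernel at an injective `y`
  obtain ⟨r, hr, ⟨i₀, j₀, hij₀, hdist₀⟩, k₁, k₂, hk, h₁, h₂⟩ := hsel y hy
  obtain ⟨m, hm, hmle, i₁, j₁, hij₁, hmeq⟩ := exists_min_dist y hy
  have hmr : m ≤ r := (hmle i₀ j₀ hij₀).trans hdist₀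
  set σ : ℝ := ∑ i, ∑ j ∈ Finset.univ.erase i, ‖y i - y j‖⁻¹ with hσ_def
  have hσ : 0 ≤ σ := Finset.sum_nonneg fun i _ => Finset.sum_nonneg fun j _ => inv_nonneg.2 (norm_nonneg _)
  have hmσ : m⁻¹ ≤ σ := by
    rw [hmeq, dist_eq_norm]
    exact inv_norm_sub_le_pairSum y hij₁
  set s : ℝ := min 1 (min (c * r) m) with hs_def
  have hcr : 0 < c * r := mul_pos hc hr
  have hs : 0 < s := lt_min one_pos (lt_min hcr hm)
  have hs1 : s ≤ 1 := min_le_left _ _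
  have hsr : s ≤ c * r := (min_le_right _ _).trans (min_le_left _ _)
  have hsm : s ≤ m := (min_le_right _ _).trans (min_le_right _ _)
  have hsd : ∀ i j, i ≠ j → s ≤ dist (y i) (y j) := fun i j hij => hsm.trans (hmle i j hij)
  obtain ⟨κ, hκc, hκb, hκrep⟩ := exists_localKernel (S₁ 3) hsymm htr3 hCst hreg hAX hDG hk h₁ h₂ hs hs1 hsr hsd
  have hρ : 0 < s / 8 / 2 := by positivity
  refine ⟨s / 8 / 2, hρ, κ, hκc, fun z hz => injective_of_mem_box (fun i j hij => ?_) hz, ?_, hκrep⟩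
  · have := hsd i j hij
    linarith
  -- the bound at the centre against the weight
  have hinv : s⁻¹ ≤ a * (1 + σ) := by
    rw [hs_def, ha_def]
    exact inv_scale_le hc hm hmr hσ hmσ
  have hY : (1 : ℝ) ≤ 1 + ‖y‖ := by linarith [norm_nonneg y]
  calc ‖κ y‖ ≤ Cst * (1 / (s / 2)) ^ pst * (B₀ * (s / 8)⁻¹ ^ q * (1 + ‖y‖) ^ q) :=
        hκb y fun i => mem_ball_self hρ
    _ ≤ (Cst * |B₀| * 2 ^ pst * 8 ^ q * a ^ (pst + q) + 1) * (1 + ‖y‖) ^ (pst + q) * (1 + σ) ^ (pst + q) :=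
        local_bound_le_weight hCst.le ha hσ hY hs hinv
    _ = Cfin * (1 + ‖y‖) ^ (pst + q) * (1 + ∑ i, ∑ j ∈ Finset.univ.erase i, ‖y i - y j‖⁻¹) ^ (pst + q) := by
        rw [hCfin_def, hσ_def]

end Summit.QuantumFields.YangMills.Theorems.TemperedCurvatureMoments.Sketch

end
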